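import Summits.QuantumFields.GaugeBoot.SOMasterLoopDerivatives
import Literature.MathematicalPhysics.QuantumFieldTheory.Chatterjee2019LargeN.LoopOperations
import HarnessLib

/-!
# Traces of insertion products on Chatterjee's edge words: arcs, rotations, cores (gauge-boot, ADDENDUM 27 part M4a)

HONEST FRAMING (cell `pub-gaugeboot`, page 1 of every file): the venture produces certified bounds
on lattice expectations at stated coupling, gauge group, dimension and torus size; NOT a mass gap,
NOT a continuum limit, NOT a string tension; NOT Yang–Mills-summit-bearing (barriers
`FixedCouplingUltralocality`, `PerturbativeInvisibility`).  Word combinatorics and trace cyclicity; nothing about a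
lattice measure is claimed here.

## Content

Fifth file of the lane's programme on the tree's NAMED FACT `Chatterjee2019LargeN.UnsymmetrizedMasterLoopEquation`
(Chatterjee, CMP 366 (2019), Theorem 8.1).  The insertion products of part M3 are positional (`List.set`); Chatterjee's
string operations are cyclic (`arcBetween`, `arcAfter`, `tailFrom` of `LatticeStrings`).  This file bridges the two:

* §1 arcs as `take`/`drop`: `tailFrom_eq`, `arcBetween_eq_of_lt/gt`, `arcAfter_eq_of_lt/gt`;
* §2 `holC U w = Π letterMat` (`= soRep(hol_w)`), its algebra (`holC_append`, `holC_invRev` — the transpose, by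
  orthogonality —, `transpose_holC_mul_self`), and the TRACE INVARIANCES of the Wilson loop variable: cyclic shifts
  (`trace_holC_append_comm`), free reduction and cyclic reduction, hence ★ `trace_holC_core` — `W_{[w]} = W_w` for the
  nonbacktracking core, so that the `core` in every operation of `LatticeStrings` is invisible to `W`;
* §3 ★ the TRACE FORMULAS: `trace_insProd` — `tr(insProd_x) = tr(insMat_x · holC(tailFrom l x))`;
  `trace_ins2Prod_self` — the diagonal `tr(ins2Prod_{x,x}) = tr(ins2Mat_x · holC(tailFrom l x))`;
  ★ `trace_ins2Prod_of_ne` — for `x ≠ y`, `tr(ins2Prod_{x,y}) = tr(insMat_x · holC(arcBetween l x y) · insMat_y ·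
  holC(arcAfter l x y))` (both orders `x < y`, `y < x`, by trace cyclicity).

References: S. Chatterjee, Comm. Math. Phys. 366 (2019) §2.2 (the words `a e b e' c`), §§6–8.  Everything is `[folklore]`.
-/

noncomputable section

open NormedSpace
open scoped Matrix.Norms.Frobenius Matrix
open Literature.MathematicalPhysics.QuantumLattice (LGConfig ZdEdge)
open Literature.MathematicalPhysics.QuantumFieldTheory (Chatterjee2019LargeN.Word Chatterjee2019LargeN.wordHolonomy)
open Literature.MathematicalPhysics.QuantumFieldTheory.Chatterjee2019LargeN
  (SO soRep soRep_apply DEdge wilsonLoopVar core isSpecialOrthogonalModel_soRep)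
open Literature.MathematicalPhysics.QuantumFieldTheory.Chatterjee2019LargeN.Word
  (tailFrom arcBetween arcAfter gap letter gap_lt gap_pos)

namespace Summit.QuantumFields.GaugeBoot

namespace SOMasterLoop

variable {d N : ℕ}

/-! ## §1 Arcs as `take` / `drop` -/

section Arcs

variable (l : Chatterjee2019LargeN.Word d)

/-- `l` rotated to `x` is `drop x ++ take x`. [folklore] -/
theorem rotate_fin_eq (x : Fin l.length) : l.rotate x = l.drop x ++ l.take x :=
  List.rotate_eq_drop_append_take x.isLt.le

/-- The cyclic tail after location `x`: `drop (x+1) ++ take x`. [folklore] -/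
theorem tailFrom_eq (x : Fin l.length) : tailFrom l x = l.drop (x + 1) ++ l.take x := by
  rw [tailFrom, rotate_fin_eq, List.drop_append_of_le_length (by rw [List.length_drop]; have := x.isLt; omega),
    List.drop_drop]

/-- The gap for `x < y`. [folklore] -/
theorem gap_eq_of_lt {x y : Fin l.length} (h : x < y) : gap l x y = (y : ℕ) - x := by
  unfold gap; exact Fin.coe_sub_iff_le.mpr h.le

/-- The gap for `y < x`. [folklore] -/
theorem gap_eq_of_gt {x y : Fin l.length} (h : y < x) : gap l x y = l.length + y - x := by
  unfold gap; exact Fin.coe_sub_iff_lt.mpr h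

/-- The arc strictly between `x < y`: `(drop (x+1)).take (y−x−1)`. [folklore] -/
theorem arcBetween_eq_of_lt {x y : Fin l.length} (h : x < y) :
    arcBetween l x y = (l.drop (x + 1)).take ((y : ℕ) - x - 1) := by
  rw [arcBetween, ← tailFrom, tailFrom_eq, gap_eq_of_lt l h,
    List.take_append_of_le_length (by rw [List.length_drop]; have := y.isLt; omega)]

/-- The arc after `y` back to `x`, for `x < y`: `drop (y+1) ++ take x`. [folklore] -/
theorem arcAfter_eq_of_lt {x y : Fin l.length} (h : x < y) :
    arcAfter l x y = l.drop (y + 1) ++ l.take x := by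
  have hx := x.isLt; have hy := y.isLt
  have hxy : (x : ℕ) < y := h
  rw [arcAfter, rotate_fin_eq, gap_eq_of_lt l h,
    List.drop_append_of_le_length (by rw [List.length_drop]; omega), List.drop_drop]
  have : (x : ℕ) + ((y : ℕ) - x + 1) = y + 1 := by omega
  rw [this]

/-- The arc strictly between `x` and `y` (cyclically) for `y < x`: `drop (x+1) ++ take y`. [folklore] -/
theorem arcBetween_eq_of_gt {x y : Fin l.length} (h : y < x) :
    arcBetween l x y = l.drop (x + 1) ++ l.take y := by
  have hx := x.isLt; have hy := y.isLt
  have hyx : (y : ℕ) < x := h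
  rw [arcBetween, ← tailFrom, tailFrom_eq, gap_eq_of_gt l h]
  have hlen : (l.drop (x + 1)).length = l.length - (x + 1) := List.length_drop
  rw [List.take_append, List.take_of_length_le (by rw [hlen]; omega), List.take_take]
  congr 1
  rw [hlen]
  congr 1
  omega

/-- The arc after `y` back to `x` for `y < x`: `(drop (y+1)).take (x−y−1)`. [folklore] -/
theorem arcAfter_eq_of_gt {x y : Fin l.length} (h : y < x) :
    arcAfter l x y = (l.drop (y + 1)).take ((x : ℕ) - y - 1) := by
  have hx := x.isLt; have hy := y.isLt
  have hyx : (y : ℕ) < x := h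
  rw [arcAfter, rotate_fin_eq, gap_eq_of_gt l h]
  have hlen : (l.drop x).length = l.length - x := List.length_drop
  rw [List.drop_append, List.drop_of_length_le (by rw [hlen]; omega), List.nil_append, hlen, List.drop_take]
  have e1 : l.length + y - x + 1 - (l.length - x) = y + 1 := by omega
  rw [e1, Nat.sub_sub]

/-- For `y < x` the two arcs are those of the pair `(y, x)` exchanged. [folklore] -/
theorem arcBetween_eq_arcAfter_of_gt {x y : Fin l.length} (h : y < x) : arcBetween l x y = arcAfter l y x := by
  rw [arcBetween_eq_of_gt l h, arcAfter_eq_of_lt l h]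

/-- For `y < x` the two arcs are those of the pair `(y, x)` exchanged. [folklore] -/
theorem arcAfter_eq_arcBetween_of_gt {x y : Fin l.length} (h : y < x) : arcAfter l x y = arcBetween l y x := by
  rw [arcAfter_eq_of_gt l h, arcBetween_eq_of_lt l h]

end Arcs

/-! ## §2 Products of letter matrices: algebra and trace invariances -/

section HolC

/-- `holC U w = Π_k letterMat U w_k` — the complexified holonomy `soRep(hol_w)` as a list product. [folklore] -/
def holC (U : LGConfig d (SO N)) (w : Chatterjee2019LargeN.Word d) : Matrix (Fin N) (Fin N) ℂ := (w.map (letterMat U)).prod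

variable (U : LGConfig d (SO N))

/-- `holC = soRep ∘ hol`. [folklore] -/
theorem holC_eq_soRep (w : Chatterjee2019LargeN.Word d) : holC U w = soRep N (Chatterjee2019LargeN.wordHolonomy U w) :=
  (soRep_wordHolonomy U w).symm

/-- `tr holC = W` (in `ℂ`). [folklore] -/
theorem trace_holC (w : Chatterjee2019LargeN.Word d) : (holC U w).trace = ((wilsonLoopVar N w U : ℝ) : ℂ) :=
  (ofReal_wilsonLoopVar N w U).symm

/-- `holC [] = 1`. [folklore] -/
@[simp] theorem holC_nil : holC U ([] : Chatterjee2019LargeN.Word d) = 1 := by simp [holC]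

/-- `holC (a :: w) = letterMat a · holC w`. [folklore] -/
theorem holC_cons (a : DEdge d) (w : Chatterjee2019LargeN.Word d) : holC U (a :: w) = letterMat U a * holC U w := by
  simp [holC]

/-- `holC (v ++ w) = holC v · holC w`. [folklore] -/
theorem holC_append (v w : Chatterjee2019LargeN.Word d) : holC U (v ++ w) = holC U v * holC U w := by
  simp [holC]

/-- `holC [a] = letterMat a`. [folklore] -/
theorem holC_singleton (a : DEdge d) : holC U [a] = letterMat U a := by simp [holC]

/-- `soRep(g⁻¹) = soRep(g)ᵀ` for `g ∈ SO(N)`. [folklore] -/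
theorem soRep_inv (g : SO N) : soRep N g⁻¹ = (soRep N g)ᵀ := by
  rw [soRep_apply, soRep_apply]
  have h : ((g⁻¹ : SO N) : Matrix (Fin N) (Fin N) ℝ) = (g : Matrix (Fin N) (Fin N) ℝ)ᵀ := by
    rw [show (g⁻¹ : SO N) = star g from rfl, Matrix.specialUnitaryGroup.coe_star, Matrix.star_eq_conjTranspose,
      Matrix.conjTranspose_eq_transpose_of_trivial]
  rw [h, Matrix.transpose_map]

/-- The letter matrix of the inverse letter is the transpose. [folklore] -/
theorem letterMat_inv (a : DEdge d) : letterMat U (DEdge.inv a) = (letterMat U a)ᵀ := by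
  rcases a with ⟨e, b⟩
  cases b <;> simp [letterMat, DEdge.inv, soRep_inv]

/-- `holC (w⁻¹) = (holC w)ᵀ` (`w⁻¹ = invRev w`, reverse and invert). [folklore] -/
theorem holC_invRev : ∀ w : Chatterjee2019LargeN.Word d, holC U (FreeGroup.invRev w) = (holC U w)ᵀ
  | [] => by simp [FreeGroup.invRev]
  | a :: w => by
    have ih := holC_invRev w
    rw [show FreeGroup.invRev (a :: w) = FreeGroup.invRev w ++ [DEdge.inv a] by
        simp [FreeGroup.invRev, DEdge.inv], holC_append, holC_singleton, ih, holC_cons, Matrix.transpose_mul,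
      letterMat_inv]

/-- Letter matrices are orthogonal: `Mᵀ M = 1`. [folklore] -/
theorem transpose_letterMat_mul_self (a : DEdge d) : (letterMat U a)ᵀ * letterMat U a = 1 := by
  rw [← letterMat_inv]
  unfold letterMat
  rw [← map_mul]
  rcases a with ⟨e, b⟩
  cases b <;> simp [DEdge.inv]

/-- Letter matrices are orthogonal: `M Mᵀ = 1`. [folklore] -/
theorem letterMat_mul_transpose_self (a : DEdge d) : letterMat U a * (letterMat U a)ᵀ = 1 := by
  rw [← letterMat_inv]
  unfold letterMat
  rw [← map_mul]
  rcases a with ⟨e, b⟩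
  cases b <;> simp [DEdge.inv]

/-- Products of letter matrices are orthogonal: `(holC w)ᵀ holC w = 1`. [folklore] -/
theorem transpose_holC_mul_self (w : Chatterjee2019LargeN.Word d) : (holC U w)ᵀ * holC U w = 1 := by
  rw [holC_eq_soRep, ← soRep_inv, ← map_mul, inv_mul_cancel, map_one]

/-- `holC w (holC w)ᵀ = 1`. [folklore] -/
theorem holC_mul_transpose_self (w : Chatterjee2019LargeN.Word d) : holC U w * (holC U w)ᵀ = 1 := by
  rw [holC_eq_soRep, ← soRep_inv, ← map_mul, mul_inv_cancel, map_one]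

/-- Cyclic invariance of the trace of a word product: `tr holC(v ++ w) = tr holC(w ++ v)`. [folklore] -/
theorem trace_holC_append_comm (v w : Chatterjee2019LargeN.Word d) : (holC U (v ++ w)).trace = (holC U (w ++ v)).trace := by
  rw [holC_append, holC_append, Matrix.trace_mul_comm]

/-- The trace is rotation invariant. [folklore] -/
theorem trace_holC_rotate (w : Chatterjee2019LargeN.Word d) (k : ℕ) : (holC U (w.rotate k)).trace = (holC U w).trace := by
  rw [List.rotate_eq_drop_append_take_mod, trace_holC_append_comm, List.take_append_drop]

/-- The trace of the transpose-word: `tr holC(w⁻¹) = tr holC(w)`. [folklore] -/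
theorem trace_holC_invRev (w : Chatterjee2019LargeN.Word d) : (holC U (FreeGroup.invRev w)).trace = (holC U w).trace := by
  rw [holC_invRev, Matrix.trace_transpose]

/-- `holC` through the free group: `holC U w = soRep (FreeGroup.lift Q (mk w))`. [folklore] -/
theorem holC_eq_lift (w : Chatterjee2019LargeN.Word d) :
    holC U w = soRep N (FreeGroup.lift (fun e : ZdEdge d => U e) (FreeGroup.mk w)) := by
  rw [FreeGroup.lift_mk, map_list_prod, List.map_map, holC]
  congr 1
  refine List.map_congr_left fun a _ => ?_
  rcases a with ⟨e, b⟩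
  cases b <;> rfl

/-- Free reduction does not change the holonomy. [folklore] -/
theorem holC_reduce (w : Chatterjee2019LargeN.Word d) : holC U (FreeGroup.reduce w) = holC U w := by
  rw [holC_eq_lift, holC_eq_lift, FreeGroup.reduce.self]

/-- Cyclic reduction does not change the trace. [folklore] -/
theorem trace_holC_reduceCyclically (w : Chatterjee2019LargeN.Word d) :
    (holC U (FreeGroup.reduceCyclically w)).trace = (holC U w).trace := by
  conv_rhs => rw [← FreeGroup.reduceCyclically.conj_conjugator_reduceCyclically w]
  rw [holC_append, holC_append, Matrix.trace_mul_cycle, holC_invRev, transpose_holC_mul_self, Matrix.one_mul]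

/-- ★ **The Wilson loop variable of the nonbacktracking core**: `tr holC(core w) = tr holC(w)` — backtrack erasure
is invisible to `W`, so the `core` in Chatterjee's operations may be dropped under the trace. [folklore] -/
theorem trace_holC_core (w : Chatterjee2019LargeN.Word d) : (holC U (core w)).trace = (holC U w).trace := by
  rw [core, trace_holC_reduceCyclically, holC_reduce]

/-- The same for `W` itself: `W_{[w]} = W_w`. [folklore] -/
theorem wilsonLoopVar_core (w : Chatterjee2019LargeN.Word d) : wilsonLoopVar N (core w) U = wilsonLoopVar N w U := by
  have h := trace_holC_core U w (N := N)
  rw [trace_holC, trace_holC] at h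
  exact_mod_cast h

end HolC

/-! ## §3 Trace formulas for the insertion products -/

section Traces

variable (ε : ZdEdge d) (X : Matrix (Fin N) (Fin N) ℂ) (U : LGConfig d (SO N)) (l : Chatterjee2019LargeN.Word d)

/-- A single replacement splits the product: `(B.set x D).prod = B_{<x} · D · B_{>x}`. [folklore] -/
theorem prod_set_of_lt {M : Type*} [Monoid M] (B : List M) {x : ℕ} (hx : x < B.length) (D : M) :
    (B.set x D).prod = (B.take x).prod * D * (B.drop (x + 1)).prod := by
  rw [List.prod_set, if_pos hx]

/-- ★ `tr(insProd_x) = tr(insMat_x · holC(tailFrom l x))`. [folklore] -/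
theorem trace_insProd (x : Fin l.length) :
    (insProd ε X l x U).trace = (insMat ε X U (l.get x) * holC U (tailFrom l x)).trace := by
  rw [insProd, prod_set_of_lt _ (by rw [List.length_map]; exact x.isLt), Matrix.trace_mul_cycle, Matrix.trace_mul_cycle,
    tailFrom_eq, holC_append]
  simp only [holC, List.map_drop, List.map_take, Matrix.mul_assoc]

/-- ★ The diagonal: `tr(ins2Prod_{x,x}) = tr(ins2Mat_x · holC(tailFrom l x))`. [folklore] -/
theorem trace_ins2Prod_self (x : Fin l.length) :
    (ins2Prod ε X l x x U).trace = (ins2Mat ε X U (l.get x) * holC U (tailFrom l x)).trace := by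
  rw [ins2Prod, if_pos rfl, List.set_set, prod_set_of_lt _ (by rw [List.length_map]; exact x.isLt),
    Matrix.trace_mul_cycle, Matrix.trace_mul_cycle, tailFrom_eq, holC_append]
  simp only [holC, List.map_drop, List.map_take, Matrix.mul_assoc]

/-- The double replacement for `x < y`. [folklore] -/
theorem prod_set_set_of_lt {M : Type*} [Monoid M] (B : List M) {x y : ℕ} (hxy : x < y) (hy : y < B.length) (Dx Dy : M) :
    ((B.set x Dx).set y Dy).prod =
      (B.take x).prod * Dx * ((B.drop (x + 1)).take (y - x - 1)).prod * Dy * (B.drop (y + 1)).prod := by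
  have hx : x < B.length := hxy.trans hy
  rw [prod_set_of_lt _ (by rw [List.length_set]; exact hy), List.take_set, List.drop_set_of_lt (by omega),
    prod_set_of_lt _ (by rw [List.length_take]; exact lt_min hxy hx), List.take_take, min_eq_left hxy.le,
    List.drop_take, Nat.sub_sub]

/-- The two insertions commute: `ins2Prod_{x,y} = ins2Prod_{y,x}` for `x ≠ y`. [folklore] -/
theorem ins2Prod_comm {x y : Fin l.length} (hxy : x ≠ y) : ins2Prod ε X l x y U = ins2Prod ε X l y x U := by
  rw [ins2Prod, ins2Prod, if_neg (Ne.symm hxy), if_neg hxy, List.set_comm _ _ (Fin.val_injective.ne hxy)]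

/-- Off-diagonal trace formula, ordered case `x < y`. [folklore] -/
theorem trace_ins2Prod_of_lt {x y : Fin l.length} (h : x < y) :
    (ins2Prod ε X l x y U).trace =
      (insMat ε X U (l.get x) * holC U (arcBetween l x y) * insMat ε X U (l.get y) * holC U (arcAfter l x y)).trace := by
  have hlen : (l.map (letterMat U)).length = l.length := List.length_map _
  rw [ins2Prod, if_neg (fun e : y = x => (lt_irrefl x) (e ▸ h)), prod_set_set_of_lt _ h (by rw [hlen]; exact y.isLt),
    arcBetween_eq_of_lt l h, arcAfter_eq_of_lt l h, holC_append]
  simp only [holC, List.map_drop, List.map_take, Matrix.mul_assoc]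
  conv_lhs => rw [Matrix.trace_mul_comm]
  simp only [Matrix.mul_assoc]

/-- ★ **Off-diagonal trace formula**: for `x ≠ y`,
`tr(ins2Prod_{x,y}) = tr(insMat_x · holC(arcBetween l x y) · insMat_y · holC(arcAfter l x y))`. [folklore] -/
theorem trace_ins2Prod_of_ne {x y : Fin l.length} (hxy : x ≠ y) :
    (ins2Prod ε X l x y U).trace =
      (insMat ε X U (l.get x) * holC U (arcBetween l x y) * insMat ε X U (l.get y) * holC U (arcAfter l x y)).trace := by
  rcases lt_or_gt_of_ne (Fin.val_injective.ne hxy) with h | h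
  · exact trace_ins2Prod_of_lt ε X U l h
  · have h' : y < x := h
    rw [ins2Prod_comm ε X U l hxy, trace_ins2Prod_of_lt ε X U l h', ← arcAfter_eq_arcBetween_of_gt l h',
      ← arcBetween_eq_arcAfter_of_gt l h', Matrix.mul_assoc _ (insMat ε X U (l.get x)), Matrix.trace_mul_comm,
      ← Matrix.mul_assoc]

end Traces

end SOMasterLoop

end Summit.QuantumFields.GaugeBoot
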